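import Mathlib
import HarnessLib
import Summits.NavierStokesRegularity.NavierStokesRegularity.Theorems.UnthreadedDoorNetFluxNF1aDeltaSlice

/-!
# Route `UnthreadedDoor`, crux `PoloidalLiouville` (stmt-NavierStokesRegularity-1222), WALL W1 `stub_scalarLiouville` —
# netflux tooling, NF-1a (Δ) side: (Δiii)/(Δiv) UNDER THE SLICE LEVEL-LIPSCHITZ HYPOTHESIS (no unimodality)

ARM A's `…ExtremalHeadCore` proves conjuncts (iii)/(iv) of `ExtremalHeadEMF` from UNIMODALITY (calling `levelLipschitz` inside).  The crux idea
«height-head» (ns-idea-14, K2 `ExtremalHeadEMFOfLevelLip`) replaces unimodality by the SLICE LEVEL-LIPSCHITZ property itself as the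
hypothesis; for that by-name closure the (Δ) side needs (iii)/(iv) in slice form, matching `NF1a.exists_headDiff_fun` (i),
`NF1a.continuousOn_headDiff_of_sliceLevelLip` (ii) and `NF1a.ae_deriv_headDiff_le_of_sliceLevelLip` (v):

* `abs_sub_le_mul_sphOsc_of_sliceLevelLip` — (Δiv) on one sphere: `|g x⁺ − g x⁻| ≤ Λ · osc_{S_r} f`, hence `≤ V · netFlux` for `Λ = V·r`
  (`abs_headDiff_le_netFlux_of_sliceLevelLip`);
* `exists_lipschitzOnWith_headDiff` — (Δiii): with `f, g ∈ C¹` off `x₀`, the slice property with a uniform constant `Λ` on the radii of `[a,b]`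
  and property (i) of `I`, `I` is Lipschitz on `[a,b]` (radial scaling of the extremisers at `r` to `S_{r'}`; the END CORRECTIONS
  `|g(x⁺(r')) − g(x̃⁺)| ≤ Λ(max_{S_{r'}}f − f(x̃⁺))` are `O(|r'−r|)` by the Lipschitz property of the envelopes — jumping extremisers are
  harmless); shell / radial / envelope helpers from ARM A's `…ExtremalHeadCore` (`exists_bound_fderiv_shell`, `abs_sub_radial_le`,
  `exists_lipschitz_sphSup_sphInf`);
* `lipschitzOnWith_headDiff_of_sliceLevelLip` — packaged as conjunct (iii) with `Λ_r = V·r`.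

WHAT THIS IS NOT: no NS-regularity statement is touched (frozen-time calculus on spheres); tooling for the residual programme of W1; NF-1a itself
is ALREADY a theorem (p675379); `PoloidalLiouville` (1222), W1 and the summit stay OPEN.  `--supports stmt-NavierStokesRegularity-1222 --as helper`.
[folklore]
-/

noncomputable section

-- the summit and its single sub-problem share the name (CONVENTIONS §1)
set_option linter.dupNamespace false

open Set Function Filter Topology InnerProductSpace MeasureTheory
open scoped RealInnerProductSpace NNReal

namespace Summit.NavierStokesRegularity.NavierStokesRegularity.Theorems.PoloidalLiouville.NetFlux.NF1a

open Literature.Analysis Literature.Analysis.FluidPDE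

variable {f g : E3 → ℝ} {x₀ : E3}

/-! ### (Δiv) under the slice property -/

/-- **(Δiv) on one sphere**: under the slice property `|g x − g y| ≤ Λ|f x − f y|` on `S_r`, `|g x⁺ − g x⁻| ≤ Λ · osc_{S_r} f` for a maximiser
`x⁺` and a minimiser `x⁻` (`f` continuous on the sphere). [folklore] -/
theorem abs_sub_le_mul_sphOsc_of_sliceLevelLip {r Λ : ℝ} (hfS : ContinuousOn f (Metric.sphere x₀ r))
    (hΛ : ∀ x ∈ Metric.sphere x₀ r, ∀ y ∈ Metric.sphere x₀ r, |g x - g y| ≤ Λ * |f x - f y|)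
    {xp xm : E3} (hxp : xp ∈ sphArgmax f x₀ r) (hxm : xm ∈ sphArgmin f x₀ r) :
    |g xp - g xm| ≤ Λ * sphOsc f x₀ r := by
  have h := hΛ xp hxp.1 xm hxm.1
  have hsup : sphSup f x₀ r = f xp := sphSup_eq_of_mem_sphArgmax hfS hxp
  have hinf : sphInf f x₀ r = f xm := sphInf_eq_of_mem_sphArgmin hfS hxm
  have hge : f xm ≤ f xp := hxp.2 xm hxm.1
  unfold sphOsc
  rw [hsup, hinf, ← abs_of_nonneg (sub_nonneg.2 hge)]
  exact h

/-- **(Δiv), packaged as conjunct (iv)**: with the slice property at every `r > 0` with constant `V·r` and property (i) of `I`,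
`|I r| ≤ V · netFlux f x₀ r` for every `r > 0` (`f` continuous off `x₀`). [folklore] -/
theorem abs_headDiff_le_netFlux_of_sliceLevelLip (hfc : ContinuousOn f ({x₀}ᶜ : Set E3)) {V : ℝ}
    (hΛ : ∀ r > 0, ∀ x ∈ Metric.sphere x₀ r, ∀ y ∈ Metric.sphere x₀ r, |g x - g y| ≤ V * r * |f x - f y|)
    {I : ℝ → ℝ} (hI : ∀ r > 0, ∀ xp ∈ sphArgmax f x₀ r, ∀ xm ∈ sphArgmin f x₀ r, I r = g xp - g xm)
    {r : ℝ} (hr : 0 < r) : |I r| ≤ V * netFlux f x₀ r := by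
  have hfS : ContinuousOn f (Metric.sphere x₀ r) := continuousOn_sphere_of_continuousOn_compl hfc hr
  obtain ⟨xp, hxp⟩ := exists_mem_sphArgmax hfS hr.le
  obtain ⟨xm, hxm⟩ := exists_mem_sphArgmin' hfS hr.le
  rw [hI r hr xp hxp xm hxm]
  have h := abs_sub_le_mul_sphOsc_of_sliceLevelLip hfS (hΛ r hr) hxp hxm
  unfold netFlux
  calc |g xp - g xm| ≤ V * r * sphOsc f x₀ r := h
    _ = V * (r * sphOsc f x₀ r) := by ring

/-! ### (Δiii) Lipschitz continuity of the head difference in `r` under the slice property -/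

/-- **(Δiii) The extremal head difference is Lipschitz in `r` on `[a,b] ⊂ ]0,∞[` under the slice property.**  Data: `f, g ∈ C¹(ℝ³ ∖ {x₀})`,
the slice level-Lipschitz property with a uniform constant `Λ ≥ 0` on the spheres of radii in `[a,b]`, and `I r = g x⁺ − g x⁻` for every
extremiser pair at every such radius.  Constant: `2‖Dg‖_shell + 2Λ(K_env + ‖Df‖_shell)`. [folklore] -/
theorem exists_lipschitzOnWith_headDiff (hf : ContDiffOn ℝ 1 f ({x₀}ᶜ : Set E3)) (hg : ContDiffOn ℝ 1 g ({x₀}ᶜ : Set E3))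
    {a b Λ : ℝ} (ha : 0 < a) (hΛ0 : 0 ≤ Λ)
    (hΛ : ∀ r ∈ Icc a b, ∀ x ∈ Metric.sphere x₀ r, ∀ y ∈ Metric.sphere x₀ r, |g x - g y| ≤ Λ * |f x - f y|)
    {I : ℝ → ℝ} (hI : ∀ r ∈ Icc a b, ∀ xp ∈ sphArgmax f x₀ r, ∀ xm ∈ sphArgmin f x₀ r, I r = g xp - g xm) :
    ∃ K : ℝ≥0, LipschitzOnWith K I (Icc a b) := by
  obtain ⟨G, hG0, hG⟩ := exists_bound_fderiv_shell hf ha (b := b)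
  obtain ⟨G', hG0', hG'⟩ := exists_bound_fderiv_shell hg ha (b := b)
  obtain ⟨KS, hKS0, hKS⟩ := exists_lipschitz_sphSup_sphInf hf ha (b := b)
  have hfc : ContinuousOn f ({x₀}ᶜ) := hf.continuousOn
  have hS : ∀ ρ : ℝ, 0 < ρ → ContinuousOn f (Metric.sphere x₀ ρ) := fun ρ hρ =>
    continuousOn_sphere_of_continuousOn_compl hfc hρ
  refine ⟨Real.toNNReal (2 * G' + 2 * Λ * (KS + G)), LipschitzOnWith.of_dist_le_mul fun r' hr' r hr => ?_⟩
  rw [Real.coe_toNNReal _ (by positivity), Real.dist_eq, Real.dist_eq]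
  have hr0 : 0 < r := ha.trans_le hr.1
  have hr0' : 0 < r' := ha.trans_le hr'.1
  -- extremisers at `r` and `r'`
  obtain ⟨xp, hxp⟩ := exists_mem_sphArgmax (hS r hr0) hr0.le
  obtain ⟨xm, hxm⟩ := exists_mem_sphArgmin' (hS r hr0) hr0.le
  obtain ⟨xp', hxp'⟩ := exists_mem_sphArgmax (hS r' hr0') hr0'.le
  obtain ⟨xm', hxm'⟩ := exists_mem_sphArgmin' (hS r' hr0') hr0'.le
  -- radial scaling of `xp`, `xm` to the sphere of radius `r'`
  obtain ⟨hup, hxpu, hxtp⟩ := radialScale_mem_sphere (x₀ := x₀) hr0 hr0'.le hxp.1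
  obtain ⟨hum, hxmu, hxtm⟩ := radialScale_mem_sphere (x₀ := x₀) hr0 hr0'.le hxm.1
  set up : E3 := r⁻¹ • (xp - x₀) with hup_def
  set um : E3 := r⁻¹ • (xm - x₀) with hum_def
  have hIr : I r = g xp - g xm := hI r hr xp hxp xm hxm
  have hIr' : I r' = g xp' - g xm' := hI r' hr' xp' hxp' xm' hxm'
  -- radial mean-value terms
  have h1 : |g (x₀ + r' • up) - g (x₀ + r • up)| ≤ G' * |r' - r| := abs_sub_radial_le hg ha hG' hup hr' hr
  have h2 : |g (x₀ + r' • um) - g (x₀ + r • um)| ≤ G' * |r' - r| := abs_sub_radial_le hg ha hG' hum hr' hr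
  have h1f : |f (x₀ + r' • up) - f (x₀ + r • up)| ≤ G * |r' - r| := abs_sub_radial_le hf ha hG hup hr' hr
  have h2f : |f (x₀ + r' • um) - f (x₀ + r • um)| ≤ G * |r' - r| := abs_sub_radial_le hf ha hG hum hr' hr
  -- envelope terms
  have h3 : |sphSup f x₀ r' - sphSup f x₀ r| ≤ KS * |r' - r| := (hKS r' hr' r hr).1
  have h4 : |sphInf f x₀ r' - sphInf f x₀ r| ≤ KS * |r' - r| := (hKS r' hr' r hr).2
  have hsup : sphSup f x₀ r = f xp := sphSup_eq_of_mem_sphArgmax (hS r hr0) hxp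
  have hsup' : sphSup f x₀ r' = f xp' := sphSup_eq_of_mem_sphArgmax (hS r' hr0') hxp'
  have hinf : sphInf f x₀ r = f xm := sphInf_eq_of_mem_sphArgmin (hS r hr0) hxm
  have hinf' : sphInf f x₀ r' = f xm' := sphInf_eq_of_mem_sphArgmin (hS r' hr0') hxm'
  -- end corrections via the slice property on `S_{r'}`
  have h5 : |g xp' - g (x₀ + r' • up)| ≤ Λ * |f xp' - f (x₀ + r' • up)| := hΛ r' hr' xp' hxp'.1 _ hxtp
  have h6 : |g xm' - g (x₀ + r' • um)| ≤ Λ * |f xm' - f (x₀ + r' • um)| := hΛ r' hr' xm' hxm'.1 _ hxtm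
  have h5' : |f xp' - f (x₀ + r' • up)| ≤ (KS + G) * |r' - r| := by
    have hle : f (x₀ + r' • up) ≤ f xp' := hxp'.2 _ hxtp
    rw [abs_of_nonneg (sub_nonneg.2 hle)]
    rw [← hxpu] at h1f
    rw [hsup', hsup] at h3
    have ha1 := (abs_le.1 h3).2
    have ha2 := (abs_le.1 h1f).1
    have e1 : (KS + G) * |r' - r| = KS * |r' - r| + G * |r' - r| := by ring
    rw [e1]
    linarith
  have h6' : |f xm' - f (x₀ + r' • um)| ≤ (KS + G) * |r' - r| := by
    have hle : f xm' ≤ f (x₀ + r' • um) := hxm'.2 _ hxtm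
    rw [abs_of_nonpos (sub_nonpos.2 hle)]
    rw [← hxmu] at h2f
    rw [hinf', hinf] at h4
    have ha1 := (abs_le.1 h4).1
    have ha2 := (abs_le.1 h2f).2
    have e1 : (KS + G) * |r' - r| = KS * |r' - r| + G * |r' - r| := by ring
    rw [e1]
    linarith
  have h5'' : |g xp' - g (x₀ + r' • up)| ≤ Λ * ((KS + G) * |r' - r|) := h5.trans (mul_le_mul_of_nonneg_left h5' hΛ0)
  have h6'' : |g xm' - g (x₀ + r' • um)| ≤ Λ * ((KS + G) * |r' - r|) := h6.trans (mul_le_mul_of_nonneg_left h6' hΛ0)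
  -- assemble
  have e : I r' - I r = ((g xp' - g (x₀ + r' • up)) + (g (x₀ + r' • up) - g (x₀ + r • up)))
      - ((g xm' - g (x₀ + r' • um)) + (g (x₀ + r' • um) - g (x₀ + r • um))) := by
    rw [hIr, hIr', ← hxpu, ← hxmu]; ring
  rw [e]
  have hA := abs_add_le (g xp' - g (x₀ + r' • up)) (g (x₀ + r' • up) - g (x₀ + r • up))
  have hB := abs_add_le (g xm' - g (x₀ + r' • um)) (g (x₀ + r' • um) - g (x₀ + r • um))
  have hC := abs_sub ((g xp' - g (x₀ + r' • up)) + (g (x₀ + r' • up) - g (x₀ + r • up)))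
    ((g xm' - g (x₀ + r' • um)) + (g (x₀ + r' • um) - g (x₀ + r • um)))
  have e2 : (2 * G' + 2 * Λ * (KS + G)) * |r' - r|
      = G' * |r' - r| + G' * |r' - r| + Λ * ((KS + G) * |r' - r|) + Λ * ((KS + G) * |r' - r|) := by ring
  rw [e2]
  linarith [hA, hB, hC, h1, h2, h5'', h6'']

/-- **(Δiii), packaged as conjunct (iii)**: with the slice property at every radius `r > 0` with constant `V·r` (`V ≥ 0`) and property (i)
at every `r > 0`, `I` is Lipschitz on every `[a,b]`, `0 < a < b`. [folklore] -/
theorem lipschitzOnWith_headDiff_of_sliceLevelLip (hf : ContDiffOn ℝ 1 f ({x₀}ᶜ : Set E3))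
    (hg : ContDiffOn ℝ 1 g ({x₀}ᶜ : Set E3)) {V : ℝ} (hV : 0 ≤ V)
    (hΛ : ∀ r > 0, ∀ x ∈ Metric.sphere x₀ r, ∀ y ∈ Metric.sphere x₀ r, |g x - g y| ≤ V * r * |f x - f y|)
    {I : ℝ → ℝ} (hI : ∀ r > 0, ∀ xp ∈ sphArgmax f x₀ r, ∀ xm ∈ sphArgmin f x₀ r, I r = g xp - g xm)
    (a b : ℝ) (ha : 0 < a) (hab : a < b) : ∃ L : NNReal, LipschitzOnWith L I (Icc a b) := by
  refine exists_lipschitzOnWith_headDiff hf hg ha (Λ := V * b) (mul_nonneg hV (ha.le.trans hab.le)) ?_ ?_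
  · intro r hr x hx y hy
    have hr0 : 0 < r := ha.trans_le hr.1
    calc |g x - g y| ≤ V * r * |f x - f y| := hΛ r hr0 x hx y hy
      _ ≤ V * b * |f x - f y| :=
          mul_le_mul_of_nonneg_right (mul_le_mul_of_nonneg_left hr.2 hV) (abs_nonneg _)
  · exact fun r hr => hI r (ha.trans_le hr.1)

end Summit.NavierStokesRegularity.NavierStokesRegularity.Theorems.PoloidalLiouville.NetFlux.NF1a

end
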